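import Literature.MathematicalPhysics.QuantumFieldTheory.Balaban1983to89.B9Thm314WholeReadingLattice
import Literature.MathematicalPhysics.QuantumFieldTheory.Balaban1983to89.B9Thm314WholePairWalks

/-!
# `Balaban1983to89.B9Thm314WholeExpansionReads` — [B9] Theorem 3.14 ∕ Theorem 3.10 (pp. 415–416, 426–427): THE LOCATED HYPOTHESIS «the partial
# sums over the walk sets approximate the letter on the read sets» (`ExpansionReads`) and the one-atom tools of the cancellation-reading proof

T. Bałaban, *Propagators for lattice gauge theories in a background field*, Commun. Math. Phys. **99** (1985) 389–434
[`Balaban1985BackgroundPropagators`, "B9"].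

statement-level skeleton of published theorems with citation tags; proofs where landed; nothing here is a claim about the Yang–Mills mass gap

THE PRINTED LOCI (verbatim).  p. 415 (3.107): *"the operator G has the expansion G = Σ_ω R₀(X₀)R_{α₁}(X₁)·⋯·R_{αₙ}(Xₙ), the sum is over walks
ω"*; p. 416: *"From (3.108) it follows that the expansion (3.107) is convergent in all norms in the inequalities (3.42)–(3.47)"*; p. 427 (proof
of Theorem 3.14): *"We take random walk expansions for both operators. Terms of these expansions are the same for walks which have all
localizations contained in Ω, or Ω^{(k)}, thus in the difference they are cancelled …"*.

THE POINT.  The N06 certificate's rows 22–23 carry the domination reading `hdom : … DominatedBySums … Kdiff …` (n06-m g2,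
`B9Thm314WholeSummation`) at def-Y's reading `Node00.kernelFamilyB … 𝔏.Kdiff 𝔏.parB` of the letter G(Ω, U) − G(Ω′, U).  The sibling
`B9Thm314WholeCancellation` PROVES that reading from ONE located hypothesis of printed shape, defined HERE: `ExpansionReads i cfg O T W U` — for
all coarse sites y, y′, every argument J with supp J ⊂ Δ(y′), every direction E of the unit ball and each of the three probe inputs Ψ ∈ {J ⊗ E,
∇*_{U,ν}(J ⊗ E), ∇*_{U,ν}∇*_{U,μ}(J ⊗ E)} (`probes`), the partial sums `Σ_{k<m} Σ_{ω ∈ W k y y′} (T ω)(U)Ψ` (`partialOp`) APPROXIMATE `O(U)Ψ` to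
every ε > 0 (`ApproxOn`) on the READ SETS of the functionals at y: the two-step neighbourhood of the block B(y) (`sup`), the one-step
neighbourhood of supp ζ for the Hölder cut-offs ζ at y (`holder`), the two-step neighbourhood of supp h for the L² cut-offs h at y (`l2`) —
what print's norm-convergent operator identity says on a finite lattice once the terms of walks not starting near y vanish near Δ(y).
* §1 `probes`, `ApproxOn`, `partialOp`, ★ `ExpansionReads`, the three probe memberships;
* §2 tools: ★ `atom_le` (one reading functional of the limit is below the bound of the partial sums — `IsReadingFn.le_of_approx` + `sum_le`),
  `exists_bound_cdsB`, `bound_probe₀∕₁∕₂`, `bound_atom` (atoms bounded over the ball; 𝔸 finite-dimensional), `le_iSup_ball(_iSup ∕ _iSup₂ ∕ _max)`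
  (an atom of a walk term is below the term's full quantity — a sup over directions of a finite sup ∕ max).

HONEST SCOPE.  A hypothesis schema + elementary bookkeeping (kernel-checked); nothing of print asserted; no expansion constructed; NOT a node discharge, NOT summit progress; one finite lattice
paper; nothing continuum, nothing about the mass gap.  Cell `pub-ymgap` (D-0062), node N06 [B9], N06-ASSIGNMENT v1 rows 22–23 (successor file of
bundle F8), seat `pub-ymgap-dag-n06-m` (g3), 2026-08-27.
-/

noncomputable section

namespace Literature.MathematicalPhysics.QuantumFieldTheory.Balaban1983to89.B9Thm314WholeExpansionReads

open Finset
open B6GlobalChartV1 (PV blkV1)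
open B6KLevelCensusIndexV1 (KIdx)
open B6Ineq2142KLevelV1 (β)
open B9GeoNormsKLevelV1 (geo9K)
open Node00 (FBondY BlkY CfgY BallY BondOpY BondParY liftY cdB cdsB lapB supInB l2OfY holderQB kernelFamilyB)
open B9Thm314WholeReadingCalculus B9Thm314WholeReadingLattice
open B9Thm314WholeSummation (DominatedBySums)
open B9Thm314WholePair (pairExpansion pairTermK)

variable {d ℓ : ℕ} {hd : 1 ≤ d + 1} {hL : Odd (ℓ + 1) ∧ 1 < ℓ + 1} {b₀ b₁ : ℝ}
variable {𝔸 : Type} [NormedRing 𝔸] [NormedAlgebra ℂ 𝔸] [CompleteSpace 𝔸]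

/-! ## §1 The located hypothesis: the partial sums over the walk sets approximate the letter on the read sets -/

section Located

variable (i : KIdx d ℓ hd hL b₀ b₁)

/-- **THE THREE PROBE INPUTS** of the bond-sector reading at an argument `J` along a direction `E`: `J ⊗ E`, `∇*_{U,ν}(J ⊗ E)`, `∇*_{U,ν}∇*_{U,μ}(J ⊗ E)`
(the inputs the thirteen quantities of `Node00.kernelFamilyB` feed to the letter). [cite: Balaban1985BackgroundPropagators, (3.42)–(3.46) pp.397–398 (the entries G∇*, ∇G∇*, G∇*∇*)] -/
def probes (U : CfgY 𝔸 i) (J : FBondY i → ℝ) (E : 𝔸) : Set (FBondY i → 𝔸) :=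
  {Ψ | Ψ = liftY J E ∨ (∃ ν : Fin (d + 1), Ψ = cdsB i U ν (liftY J E)) ∨
    ∃ ν μ : Fin (d + 1), Ψ = cdsB i U ν (cdsB i U μ (liftY J E))}

/-- **ε-APPROXIMATION ON A SET**: for every ε > 0 some member of the sequence `P` is ε-close to `Φ` at every point of `S`.
[cite: Balaban1985BackgroundPropagators, Thm 3.10 proof p.416 («convergent in all norms»), bookkeeping] -/
def ApproxOn (S : Set (FBondY i)) (Φ : FBondY i → 𝔸) (P : ℕ → FBondY i → 𝔸) : Prop :=
  ∀ ε : ℝ, 0 < ε → ∃ m, ∀ x ∈ S, ‖Φ x - P m x‖ ≤ ε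

variable {B : B9.Backgrounds} {E : B9.RWExpansion (geo9K i) B}

/-- **THE PARTIAL SUMS OF THE WALK TERMS** from y to y′, applied to an input: `Σ_{k<m} Σ_{ω ∈ W k y y′} (T ω)(U)Ψ`.
[cite: Balaban1985BackgroundPropagators, (3.107) p.415] -/
def partialOp (W : ℕ → (geo9K i).Site → (geo9K i).Site → Finset E.Walk) (T : E.Walk → BondOpY 𝔸 i) (U : CfgY 𝔸 i)
    (y y' : (geo9K i).Site) (Ψ : FBondY i → 𝔸) (m : ℕ) : FBondY i → 𝔸 :=
  ∑ k ∈ Finset.range m, ∑ ω ∈ W k y y', T ω U Ψ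

/-- ★ **THE EXPANSION IS READ ON THE READ SETS** (the located content of p. 427 ∕ p. 416 for the letter `O` with walk terms `T ω` and walk sets
`W`, at the background U): for all coarse sites y, y′, every argument J with supp J ⊂ Δ(y′), every direction E of the unit ball and every probe
input Ψ, the partial sums over `W · y y′` approximate `O(U)Ψ` — on the two-step neighbourhood of the block B(y) (`sup`: the (3.42)∕(3.44)
entries), on the one-step neighbourhood of supp ζ for every Hölder cut-off ζ at y (`holder`: (3.43)∕(3.45)), and on the two-step neighbourhood
of supp h for every L² cut-off h at y (`l2`: (3.46)).  A HYPOTHESIS SCHEMA on the instance's expansion; nothing asserted.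
[cite: Balaban1985BackgroundPropagators, Thm 3.14 proof p.427 + Thm 3.10 (3.107) p.415 + p.416] -/
structure ExpansionReads (cfg : B.Cfg → CfgY 𝔸 i) (O : BondOpY 𝔸 i) (T : E.Walk → BondOpY 𝔸 i)
    (W : ℕ → (geo9K i).Site → (geo9K i).Site → Finset E.Walk) (U : B.Cfg) : Prop where
  sup : ∀ (y y' : (geo9K i).Site) (J : FBondY i → ℝ), (geo9K i).suppIn (Sum.inr J) y' → ∀ (e : BallY 𝔸),
    ∀ Ψ ∈ probes i (cfg U) J (e : 𝔸),
      ApproxOn i (nb1 i (nb1 i {x | blkV1 i.hN i.D x = β i.hN i.D i.hk y})) (O (cfg U) Ψ) (partialOp i W T (cfg U) y y' Ψ)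
  holder : ∀ (y y' : (geo9K i).Site) (J : FBondY i → ℝ), (geo9K i).suppIn (Sum.inr J) y' → ∀ z : FBondY i → ℝ,
    (geo9K i).cutIn (Sum.inr z) y → ∀ (e : BallY 𝔸), ∀ Ψ ∈ probes i (cfg U) J (e : 𝔸),
      ApproxOn i (nb1 i {x | z x ≠ 0}) (O (cfg U) Ψ) (partialOp i W T (cfg U) y y' Ψ)
  l2 : ∀ (y y' : (geo9K i).Site) (J : FBondY i → ℝ), (geo9K i).suppIn (Sum.inr J) y' → ∀ h : FBondY i → ℝ,
    (geo9K i).cutIn (Sum.inr h) y → ∀ (e : BallY 𝔸), ∀ Ψ ∈ probes i (cfg U) J (e : 𝔸),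
      ApproxOn i (nb1 i (nb1 i {x | h x ≠ 0})) (O (cfg U) Ψ) (partialOp i W T (cfg U) y y' Ψ)

variable {i}

/-- `J ⊗ E` is a probe. [cite: Balaban1985BackgroundPropagators, (3.42) p.397, bookkeeping] -/
theorem liftY_mem_probes (U : CfgY 𝔸 i) (J : FBondY i → ℝ) (E : 𝔸) : liftY J E ∈ probes i U J E := Or.inl rfl
/-- `∇*_ν(J ⊗ E)` is a probe. [cite: Balaban1985BackgroundPropagators, (3.42) p.397 (G∇*), bookkeeping] -/
theorem cdsB_mem_probes (U : CfgY 𝔸 i) (J : FBondY i → ℝ) (E : 𝔸) (ν : Fin (d + 1)) :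
    cdsB i U ν (liftY J E) ∈ probes i U J E := Or.inr (Or.inl ⟨ν, rfl⟩)
/-- `∇*_ν∇*_μ(J ⊗ E)` is a probe. [cite: Balaban1985BackgroundPropagators, (3.46) p.398 (G∇*∇*), bookkeeping] -/
theorem cdsB_cdsB_mem_probes (U : CfgY 𝔸 i) (J : FBondY i → ℝ) (E : 𝔸) (ν μ : Fin (d + 1)) :
    cdsB i U ν (cdsB i U μ (liftY J E)) ∈ probes i U J E := Or.inr (Or.inr ⟨ν, μ, rfl⟩)

end Located

/-! ## §2 Tools: an atom is below the bound; atoms are bounded over the ball; the sign is immaterial -/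

section Tools

variable {i : KIdx d ℓ hd hL b₀ b₁} {B : B9.Backgrounds} {E : B9.RWExpansion (geo9K i) B}

/-- **ONE ATOM**: a reading functional F on S of `Φ` is below b as soon as F of each walk term is below the summand `q ω`, the partial sums of
`q` are below b, and the partial sums of the terms approximate Φ on S. [cite: Balaban1985BackgroundPropagators, Thm 3.10 proof p.416] -/
theorem atom_le {F : (FBondY i → 𝔸) → ℝ} {S : Set (FBondY i)} (hF : IsReadingFn F S)
    (W : ℕ → (geo9K i).Site → (geo9K i).Site → Finset E.Walk) (T : E.Walk → BondOpY 𝔸 i) (U : CfgY 𝔸 i)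
    (y y' : (geo9K i).Site) (Ψ : FBondY i → 𝔸) {Φ : FBondY i → 𝔸} {q : E.Walk → ℝ} {b : ℝ}
    (hle : ∀ ω, F (T ω U Ψ) ≤ q ω) (hsum : ∀ m, ∑ k ∈ Finset.range m, ∑ ω ∈ W k y y', q ω ≤ b)
    (happ : ApproxOn i S Φ (partialOp i W T U y y' Ψ)) : F Φ ≤ b :=
  hF.le_of_approx (P := partialOp i W T U y y' Ψ)
    (fun m => ((hF.sum_le _ _).trans (Finset.sum_le_sum fun _ _ => hF.sum_le _ _)).trans
      ((Finset.sum_le_sum fun _ _ => Finset.sum_le_sum fun ω _ => hle ω).trans (hsum m)))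
    happ

/-- `∇*_{U,ν}` is globally bounded: ‖∇*_νΨ‖ ≤ C‖Ψ‖. [cite: Balaban1985BackgroundPropagators, (3.8) p.392, bookkeeping] -/
theorem exists_bound_cdsB (U : CfgY 𝔸 i) (ν : Fin (d + 1)) :
    ∃ C : ℝ, 0 ≤ C ∧ ∀ Ψ : FBondY i → 𝔸, ‖cdsB i U ν Ψ‖ ≤ C * ‖Ψ‖ := by
  obtain ⟨C, hC, h⟩ := exists_global_of_isLocalOp (isLocalOp_cdsB (i := i) U ν Set.univ)
  exact ⟨C, hC, fun Ψ => (pi_norm_le_iff_of_nonneg (mul_nonneg hC (norm_nonneg _))).2 fun x => h Ψ x (Set.mem_univ x)⟩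

/-- the probe `J ⊗ E` is bounded over the ball. [cite: Balaban1985BackgroundPropagators, (3.39) p.397, bookkeeping] -/
theorem bound_probe₀ (J : FBondY i → ℝ) : ∃ C : ℝ, ∀ e : BallY 𝔸, ‖liftY J (e : 𝔸)‖ ≤ C :=
  ⟨‖J‖, fun e => norm_liftY_pi_le (i := i) J e⟩

/-- the probe `∇*_ν(J ⊗ E)` is bounded over the ball. [cite: Balaban1985BackgroundPropagators, (3.42) p.397, bookkeeping] -/
theorem bound_probe₁ (U : CfgY 𝔸 i) (J : FBondY i → ℝ) (ν : Fin (d + 1)) :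
    ∃ C : ℝ, ∀ e : BallY 𝔸, ‖cdsB i U ν (liftY J (e : 𝔸))‖ ≤ C := by
  obtain ⟨C, hC, h⟩ := exists_bound_cdsB (i := i) U ν
  exact ⟨C * ‖J‖, fun e => (h _).trans (mul_le_mul_of_nonneg_left (norm_liftY_pi_le (i := i) J e) hC)⟩

/-- the probe `∇*_ν∇*_μ(J ⊗ E)` is bounded over the ball. [cite: Balaban1985BackgroundPropagators, (3.46) p.398, bookkeeping] -/
theorem bound_probe₂ (U : CfgY 𝔸 i) (J : FBondY i → ℝ) (ν μ : Fin (d + 1)) :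
    ∃ C : ℝ, ∀ e : BallY 𝔸, ‖cdsB i U ν (cdsB i U μ (liftY J (e : 𝔸)))‖ ≤ C := by
  obtain ⟨C, hC, h⟩ := exists_bound_cdsB (i := i) U ν
  obtain ⟨D, hD⟩ := bound_probe₁ (i := i) U J μ
  exact ⟨C * D, fun e => (h _).trans (mul_le_mul_of_nonneg_left (hD e) hC)⟩

variable [FiniteDimensional ℂ 𝔸]

/-- **ATOMS ARE BOUNDED OVER THE BALL** (𝔸 finite-dimensional): F(X(Ψ_e)) ≤ C for a reading functional F, a ℂ-linear letter X and a bounded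
probe family Ψ_e. [cite: Balaban1985BackgroundPropagators, (3.39) p.397 (sup over directions), bookkeeping] -/
theorem bound_atom {F : (FBondY i → 𝔸) → ℝ} {S : Set (FBondY i)} (hF : IsReadingFn F S)
    (X : (FBondY i → 𝔸) →ₗ[ℂ] (FBondY i → 𝔸)) {inp : BallY 𝔸 → FBondY i → 𝔸} (hinp : ∃ C : ℝ, ∀ e, ‖inp e‖ ≤ C) :
    ∃ C : ℝ, ∀ e : BallY 𝔸, F (X (inp e)) ≤ C := by
  obtain ⟨CF, hCF, hF'⟩ := exists_global_of_isReadingFn hF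
  obtain ⟨CX, hCX, hX⟩ := exists_opBound (i := i) X
  obtain ⟨Ci, hi⟩ := hinp
  refine ⟨CF * (CX * Ci), fun e => (hF' _).trans (mul_le_mul_of_nonneg_left ?_ hCF)⟩
  have hCi : 0 ≤ Ci := (norm_nonneg _).trans (hi e)
  exact (pi_norm_le_iff_of_nonneg (mul_nonneg hCX hCi)).2 fun x => (hX _ x).trans (mul_le_mul_of_nonneg_left (hi e) hCX)

omit [FiniteDimensional ℂ 𝔸] in
/-- below the sup over the ball of a bounded family. [cite: Balaban1985BackgroundPropagators, (3.39) p.397, bookkeeping] -/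
theorem le_iSup_ball {A : BallY 𝔸 → ℝ} (hA : ∃ C : ℝ, ∀ e, A e ≤ C) (e : BallY 𝔸) : A e ≤ ⨆ e', A e' := by
  obtain ⟨C, hC⟩ := hA
  exact le_ciSup (bddAbove_range_of_le C hC) e

omit [FiniteDimensional ℂ 𝔸] in
/-- below the sup over the ball of a finite sup of bounded families. [cite: Balaban1985BackgroundPropagators, (3.39) p.397 («max_μ»), bookkeeping] -/
theorem le_iSup_ball_iSup {ι : Type} [Fintype ι] [Nonempty ι] {A : BallY 𝔸 → ι → ℝ} (hA : ∀ ν, ∃ C : ℝ, ∀ e, A e ν ≤ C)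
    (e : BallY 𝔸) (ν : ι) : A e ν ≤ ⨆ e', ⨆ ν', A e' ν' := by
  choose C hC using hA
  exact le_ciSup_of_le (bddAbove_range_of_le (⨆ ν', C ν') fun e' => ciSup_mono (Set.finite_range _).bddAbove fun ν' => hC ν' e')
    e (le_ciSup (f := fun ν' => A e ν') (Set.finite_range _).bddAbove ν)

omit [FiniteDimensional ℂ 𝔸] in
/-- below the sup over the ball of a double finite sup of bounded families. [cite: Balaban1985BackgroundPropagators, (3.44)–(3.46) p.398, bookkeeping] -/
theorem le_iSup_ball_iSup₂ {ι : Type} [Fintype ι] [Nonempty ι] {A : BallY 𝔸 → ι → ι → ℝ} (hA : ∀ ν μ, ∃ C : ℝ, ∀ e, A e ν μ ≤ C)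
    (e : BallY 𝔸) (ν μ : ι) : A e ν μ ≤ ⨆ e', ⨆ ν', ⨆ μ', A e' ν' μ' := by
  choose C hC using hA
  have hν : ∀ e' ν', (⨆ μ', A e' ν' μ') ≤ ⨆ μ', C ν' μ' :=
    fun e' ν' => ciSup_mono (Set.finite_range _).bddAbove fun μ' => hC ν' μ' e'
  refine le_ciSup_of_le (bddAbove_range_of_le (⨆ ν', ⨆ μ', C ν' μ') fun e' =>
    ciSup_mono (Set.finite_range _).bddAbove fun ν' => hν e' ν') e ?_
  exact le_ciSup_of_le (f := fun ν' => ⨆ μ', A e ν' μ') (Set.finite_range _).bddAbove ν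
    (le_ciSup (f := fun μ' => A e ν μ') (Set.finite_range _).bddAbove μ)

omit [FiniteDimensional ℂ 𝔸] in
/-- below the sup over the ball of a max of two finite sups of bounded families (the (3.43) entry). [cite: Balaban1985BackgroundPropagators, (3.43) p.398, bookkeeping] -/
theorem le_iSup_ball_max {ι : Type} [Fintype ι] [Nonempty ι] {A A' : BallY 𝔸 → ι → ℝ} (hA : ∀ ν, ∃ C : ℝ, ∀ e, A e ν ≤ C)
    (hA' : ∀ ν, ∃ C : ℝ, ∀ e, A' e ν ≤ C) (e : BallY 𝔸) (ν : ι) :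
    A e ν ≤ ⨆ e', max (⨆ ν', A e' ν') (⨆ ν', A' e' ν') ∧ A' e ν ≤ ⨆ e', max (⨆ ν', A e' ν') (⨆ ν', A' e' ν') := by
  choose C hC using hA
  choose C' hC' using hA'
  have hb : BddAbove (Set.range fun e' => max (⨆ ν', A e' ν') (⨆ ν', A' e' ν')) :=
    bddAbove_range_of_le (max (⨆ ν', C ν') (⨆ ν', C' ν')) fun e' => max_le_max
      (ciSup_mono (Set.finite_range _).bddAbove fun ν' => hC ν' e') (ciSup_mono (Set.finite_range _).bddAbove fun ν' => hC' ν' e')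
  exact ⟨le_ciSup_of_le hb e ((le_ciSup (f := fun ν' => A e ν') (Set.finite_range _).bddAbove ν).trans (le_max_left _ _)),
    le_ciSup_of_le hb e ((le_ciSup (f := fun ν' => A' e ν') (Set.finite_range _).bddAbove ν).trans (le_max_right _ _))⟩

end Tools


end Literature.MathematicalPhysics.QuantumFieldTheory.Balaban1983to89.B9Thm314WholeExpansionReads

end
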